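import Literature.AnabelianGeometry.AbsoluteAnabelian.HolomorphicEllipticCuspidalization
import Literature.AnabelianGeometry.AbsoluteAnabelian.AutHolomorphicSpacesTransportProofs
import Literature.Geometry.Kaehler.ComplexTorusLieGroupInstances
import Mathlib.Geometry.Manifold.Algebra.LieGroup
import Mathlib.Geometry.Manifold.MFDeriv.Basic

/-!
# [AbsTopIII] Cor 2.7 (c), sub-node (c).4: every punctured elliptic curve is the model punctured torus
# — PROVED modulo the genus-one uniformization theorem (c).3

Proof-only companion (no definitions) of
`Literature/AnabelianGeometry/AbsoluteAnabelian/HolomorphicEllipticCuspidalization.lean`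
(abc-iut-L4-t12; sub-DAG plan/L4/SUBDAG-AbsTopIII-Cor-27.md, row r14).

S. Mochizuki, *Topics in Absolute Anabelian Geometry III*, Cor. 2.7 (c) (kurims p. 59) speaks of
"[the elliptic curve determined by] `E`" for `E` "the Aut-holomorphic space associated to a
once-punctured elliptic curve": the typed hypothesis
`TorsionPointsDenseUniqueGroupLaw.IsPuncturedEllipticCurve E` (conformal: `E` is biholomorphic to
`T ∖ {t₀}` for a compact connected Riemann surface `T` homeomorphic to a torus) must be converted
into a biholomorphism with the MODEL punctured torus `𝔼 = ℂ/Φ(ℤ²) ∖ {0}` of the statements file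
(`PuncturedEllipticCurveModel`, sub-node (c).4).  The table records (c).4 as "(c).3 followed by a
translation moving `t₀` to `0` and restriction to the complements", (c).3 being the classical
genus-one uniformization theorem `GenusOneUniformization` (Farkas–Kra IV.6.1 (c); GAP-LEDGER
G-L4t12g4-1, a named classical INPUT).  This file proves exactly that implication:

* `puncturedEllipticCurveModel_of_genusOneUniformization :
    GenusOneUniformization → PuncturedEllipticCurveModel`.

Ingredients: the complex torus `ComplexTorus Φ` is a complex Lie group (the tree's
`ComplexTorus.instLieAddGroupComplex`), so the translation `y ↦ y - e₂ t₀` and its inverse are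
holomorphic; holomorphy passes to and from open subtypes (`TopologicalSpace.Opens` with Mathlib's
restricted charted-space structure) by the tree's `mdifferentiableAt_opens_iff` /
`mdifferentiableAt_opens_cod_iff` (`AutHolomorphicSpacesTransportProofs.lean`).

HONEST FRAMING: a step of a refereed paper ([AbsTopIII]) reduced to a named classical theorem; nothing
here bears on the disputed [IUTchIII] Cor. 3.12; typed ≠ proved for (c).3 itself.
-/

noncomputable section

namespace Literature.AnabelianGeometry.AbsoluteAnabelian

open _root_.TopologicalSpace _root_.Topology
open scoped _root_.Manifold _root_.ContDiff
open Literature.Geometry.Kaehler (ComplexTorus)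

namespace HolomorphicEllipticCuspidalization

/-! ### Sub-node (c).4 from (c).3 -/

/-- **[AbsTopIII] Cor 2.7 (c), sub-node (c).4 ⟸ (c).3**: granted the genus-one uniformization
theorem (`GenusOneUniformization`: a compact connected Riemann surface homeomorphic to a torus is
biholomorphic to some `ComplexTorus Φ`), every punctured elliptic curve in the typed conformal sense
(`TorsionPointsDenseUniqueGroupLaw.IsPuncturedEllipticCurve E`: `E ≅ T ∖ {t₀}` biholomorphically) is
biholomorphic to the MODEL punctured torus `𝔼 = ℂ/Φ(ℤ²) ∖ {0}` (`PuncturedEllipticCurveModel`):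
compose with `T ⥲ ℂ/Φ(ℤ²)`, translate by `-e₂(t₀)` (holomorphic with holomorphic inverse, the torus
being a complex Lie group) and restrict to the punctured complements — "(c).3 followed by a
translation moving `t₀` to `0` and restriction to the complements" (SUBDAG-AbsTopIII-Cor-27 r14;
"[the elliptic curve determined by] `E`"). [cite: MochizukiAbsTopIII2015, Corollary 2.7 (c) p.59] -/
theorem puncturedEllipticCurveModel_of_genusOneUniformization (hG : GenusOneUniformization) :
    PuncturedEllipticCurveModel := by
  intro E _ _ _ _ hE
  obtain ⟨T, _, _, _, _, _, _, t₀, e, ⟨hT⟩, he, hesymm⟩ := hE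
  obtain ⟨Φ, e₂, he₂, he₂symm⟩ := hG T ⟨hT⟩
  -- the translation moving `e₂ t₀` to `0`, and the composite `ψ : T ⥲ ℂ/Φ(ℤ²)` with `ψ t₀ = 0`
  set a : ComplexTorus Φ := e₂ t₀ with ha
  let τ : ComplexTorus Φ ≃ₜ ComplexTorus Φ := Homeomorph.subRight a
  let ψ : T ≃ₜ ComplexTorus Φ := e₂.trans τ
  have hψ_apply : ∀ t : T, ψ t = e₂ t - a := fun t => rfl
  have hψ_symm_apply : ∀ y : ComplexTorus Φ, ψ.symm y = e₂.symm (y + a) := fun y => rfl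
  -- the punctured source as an open subspace of `T`
  let U₀ : Opens T := ⟨{t₀}ᶜ, isOpen_compl_singleton⟩
  have hψU : ∀ t : T, t ∈ (U₀ : Set T) ↔ ψ t ∈ (puncturedTorus Φ : Set (ComplexTorus Φ)) := by
    intro t
    change t ∈ ({t₀}ᶜ : Set T) ↔ ψ t ∈ ({0}ᶜ : Set (ComplexTorus Φ))
    rw [Set.mem_compl_singleton_iff, Set.mem_compl_singleton_iff, hψ_apply, sub_ne_zero, ha,
      e₂.injective.ne_iff]
  -- holomorphy of the translation and of its inverse (complex Lie group structure of the torus)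
  have hτ : MDifferentiable 𝓘(ℂ, ℂ) 𝓘(ℂ, ℂ) (fun y : ComplexTorus Φ => y - a) :=
    (contMDiff_id.sub contMDiff_const (n := ω)).mdifferentiable (by simp)
  have hτ' : MDifferentiable 𝓘(ℂ, ℂ) 𝓘(ℂ, ℂ) (fun y : ComplexTorus Φ => y + a) :=
    (contMDiff_id.add contMDiff_const (n := ω)).mdifferentiable (by simp)
  -- the model isomorphism `E ⥲ 𝔼`
  let e₀ : E ≃ₜ U₀ := e
  let e' : E ≃ₜ ↥(puncturedTorus Φ) := e₀.trans (ψ.subtype hψU)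
  refine ⟨Φ, e', ?_, ?_⟩
  · -- `E → 𝔼` is holomorphic: its composite with `𝔼 ⊆ ℂ/Φ(ℤ²)` is `(· - a) ∘ e₂ ∘ (E → T)`
    intro x
    refine (mdifferentiableAt_opens_cod_iff (Ψ := fun x => e' x) x).2 ?_
    have hfun : (Subtype.val ∘ fun y => e' y) =
        (fun y : ComplexTorus Φ => y - a) ∘ e₂ ∘ fun x => ((e x : ({t₀}ᶜ : Set T)) : T) := rfl
    rw [hfun]
    exact ((hτ.comp he₂).comp he) x
  · -- `𝔼 → E` is holomorphic: it is `(U₀ → E) ∘ (𝔼 → U₀)`, the second map being the restriction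
    -- to the open subspaces of `e₂⁻¹ ∘ (· + a)`
    have hr : MDifferentiable 𝓘(ℂ, ℂ) 𝓘(ℂ, ℂ) (fun y : ↥(puncturedTorus Φ) =>
        (⟨e₂.symm ((y : ComplexTorus Φ) + a), (by
          have := (hψU (e₂.symm ((y : ComplexTorus Φ) + a))).2
          apply this
          rw [hψ_apply, e₂.apply_symm_apply, add_sub_cancel_right]
          exact y.2)⟩ : U₀)) := fun y =>
      (mdifferentiableAt_opens_iff (Φ := fun z : ComplexTorus Φ => e₂.symm (z + a))
        (fun _ => rfl) y).2 ((he₂symm.comp hτ') y)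
    have hfun : (fun y => e'.symm y) =
        (fun t : U₀ => e.symm ⟨t.1, t.2⟩) ∘ fun y : ↥(puncturedTorus Φ) =>
          (⟨e₂.symm ((y : ComplexTorus Φ) + a), (by
            have := (hψU (e₂.symm ((y : ComplexTorus Φ) + a))).2
            apply this
            rw [hψ_apply, e₂.apply_symm_apply, add_sub_cancel_right]
            exact y.2)⟩ : U₀) := rfl
    intro y
    have : MDifferentiableAt 𝓘(ℂ, ℂ) 𝓘(ℂ, ℂ) (fun y => e'.symm y) y := by
      rw [hfun]
      exact (hesymm.comp hr) y
    exact this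

end HolomorphicEllipticCuspidalization

end Literature.AnabelianGeometry.AbsoluteAnabelian

end
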